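import Mathlib
import Summits.Ventures.PercRepro2.RootLeafA3
import Summits.Ventures.PercRepro2.HalfL

/-!
# The two halves of (HCOV) when a ROOT is a leaf at `a₃` (blind cell PercRepro2, night-1 g36)

`RootLeafA3.Gc_root_leaf_a3` writes the crux functional, when the root `a₁` is a leaf at `a₃`
through the single edge `f` (`q = p f`, `Z = P(a₂ ↮ a₃)`), as
`Gc = 2 q (1 − q) (1 − q + q Z) · [C(oH, bH) − C(oH, bL)]` with the cleared covariances `C` of the
roots `(a₃, a₂)`.  This file refines it TERM BY TERM to the two `b`-halves of `SharpHalves.lean`: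

* **`GammaLc_root_leaf_a3`**: `ΓLc = − 2 q (1 − q) (1 − q + q Z) · C(oH, bL)` (`bL = {a₃ ↔ b}`);
* **`GammaHc_root_leaf_a3`**: `ΓHc = 2 q (1 − q) (1 − q + q Z) · C(oH, bH)`;

so HALF-L is exactly BHK06 Thm 1.4 (cross cluster, `C(oH, bL) ≤ 0`) and HALF-H exactly BHK06
Thm 1.3 (same cluster `C(a₂)` given `a₃ ∉ C(a₂)`, `C(oH, bH) ≥ 0`) in this class:
**`HalfL_root_leaf_a3`**, **`HalfH_root_leaf_a3`** (the root `a₁` a leaf at `a₃`), and by the root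
symmetry `GammaHc_eq_swap` the mirror class — the root `a₂` a leaf at `a₃` — **`HalfL_root_leaf_a3'`**
and **`HalfH_root_leaf_a3'`**.

Reading (night-1 g36, proofs/NIGHT1-G36.md): with `a₂` a leaf at `a₃` the `L`-half is the
pendant-root instance of the `(Z, 1_T)`-fibre decomposition of HALF-L (`Z = C_{G−a₃}(a₂)`): the
whole of HALF-L there is the vdBK-pair covariance `Cov(a₁ ↔ b, a₁ ↔ o | a₁ ↮ a₃)` of the roots
`(a₁, a₃)`, and `E[Ξ_γ | Q] = 0`.  Own exact checks (mining/night-1/g36/gammalc.py): both identities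
on 20 / 20 random instances `n ≤ 6`, weights `k/10`.
-/

namespace Summit.Ventures.PercRepro2

open UnionCluster CovForm RootLeafA3

namespace HalfLRootLeaf

variable {V : Type*} {E : Type*} [Fintype E] [DecidableEq E] {R : Type*} [Field R]
  [LinearOrder R] [IsStrictOrderedRing R]

section Identities

variable [Fintype V] [DecidableEq V] (p : E → R) (ends : E → Sym2 V)

omit [Fintype V] [DecidableEq V] [LinearOrder R] [IsStrictOrderedRing R] in
/-- **The `L`-half at a root leaf**: with the root `a₁` a leaf at `a₃` through `f` (`q = p f`),
`Z = P(a₂ ↮ a₃)` and the cleared cross covariance `C(oH, bL)` of the roots `(a₃, a₂)`,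
`ΓLc = − 2 q (1 − q) (1 − q + q Z) · C(oH, bL)`. -/
theorem GammaLc_root_leaf_a3 {f : E} {a₁ a₃ : V} (hf : ends f = s(a₁, a₃))
    (hleaf : ∀ e, a₁ ∈ ends e → e = f) (h13 : a₁ ≠ a₃) {o a₂ b : V} (h12 : a₁ ≠ a₂)
    (ho : o ≠ a₁) (hb : b ≠ a₁) :
    SharpHalves.GammaLc p ends o a₁ a₂ a₃ b =
      - (2 * p f * (1 - p f) * (1 - p f + p f * prob p (avoidAll ends a₂ {a₃})) *
        PendantRoot.covC p ends a₃ a₂ (connEvent ends a₂ o) (connEvent ends a₃ b)) := by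
  have h21 : a₂ ≠ a₁ := Ne.symm h12
  have c₂o : PendantRoot.Free f (connEvent ends a₂ o) := PendantRoot.free_connEvent hf hleaf h13 h21 ho
  have c₂b : PendantRoot.Free f (connEvent ends a₂ b) := PendantRoot.free_connEvent hf hleaf h13 h21 hb
  unfold SharpHalves.GammaLc DEF EQo EQ3 EQ3o Do PendantRoot.covC
  rw [prob_Q p hf hleaf h13 h12, prob_univ,
    prob_Q_inter_LL p hf hleaf h13 h12 ho hb,
    prob_Q_inter_R p hf hleaf h13 h12 hb c₂o,
    prob_Q_inter_L₀ p hf hleaf h13 h12 ho, prob_Q_inter p hf hleaf h13 h12 c₂o,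
    prob_T'_inter_L₀ p hf hleaf h13 h12 hb,
    prob_T_inter_L₀ p hf hleaf h13 hb,
    prob_T'_inter_LL p hf hleaf h13 h12 ho hb, prob_T'_inter_R p hf hleaf h13 h12 hb c₂o,
    prob_T_inter_L p hf hleaf h13 ho (connEvent ends a₁ b),
    prob_T_inter_R p hf hleaf h13 hb (connEvent ends a₂ o),
    RootLeafA3.prob_T' p hf hleaf h13 h12, RootLeafA3.prob_T p hf hleaf h13 h12,
    prob_T'_inter_L₀ p hf hleaf h13 h12 ho, RootLeafA3.prob_T'_inter p hf hleaf h13 h12 c₂o,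
    prob_T_inter_L₀ p hf hleaf h13 ho, RootLeafA3.prob_T_inter p hf hleaf h13 h12 c₂o,
    prob_PD_inter_L₀ p hf hleaf h13 hb,
    prob_PD_inter_L p hf hleaf h13 ho (connEvent ends a₁ b),
    prob_PD_inter_R p hf hleaf h13 hb (connEvent ends a₂ o),
    prob_PD_inter_L₀ p hf hleaf h13 ho, RootLeafA3.prob_PD_inter p hf hleaf h13 h12 c₂o,
    RootLeafA3.prob_PD p hf hleaf h13 h12, prob_Q_inter_L₀ p hf hleaf h13 h12 hb]
  -- decompose the free masses over `Q¹ ⊔ {a₂ ↔ a₃}`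
  rw [prob_decomp p ends a₂ a₃ (connEvent ends a₂ o), prob_Q1]
  ring

omit [Fintype V] [DecidableEq V] in
/-- **The `H`-half at a root leaf**: `ΓHc = 2 q (1 − q) (1 − q + q Z) · C(oH, bH)`. -/
theorem GammaHc_root_leaf_a3 {f : E} {a₁ a₃ : V} (hf : ends f = s(a₁, a₃))
    (hleaf : ∀ e, a₁ ∈ ends e → e = f) (h13 : a₁ ≠ a₃) {o a₂ b : V} (h12 : a₁ ≠ a₂)
    (ho : o ≠ a₁) (hb : b ≠ a₁) :
    SharpHalves.GammaHc p ends o a₁ a₂ a₃ b =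
      2 * p f * (1 - p f) * (1 - p f + p f * prob p (avoidAll ends a₂ {a₃})) *
        PendantRoot.covC p ends a₃ a₂ (connEvent ends a₂ o) (connEvent ends a₂ b) := by
  have hG := Gc_root_leaf_a3 p ends hf hleaf h13 h12 ho hb
  have hL := GammaLc_root_leaf_a3 p ends hf hleaf h13 h12 ho hb
  have hsum := SharpHalves.Gc_eq_halves p ends o a₁ a₂ a₃ b
  linear_combination hG - hsum - hL

end Identities

section Theorems

variable [Fintype V] [DecidableEq V] (p : E → R) (ends : E → Sym2 V)

/-- **HALF-L when the root `a₁` is a leaf at `a₃`**: BHK06 Thm 1.4 cross cluster (`C(oH, bL) ≤ 0`). -/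
theorem HalfL_root_leaf_a3 (hp : IsProbVec p) {f : E} {a₁ a₃ : V} (hf : ends f = s(a₁, a₃))
    (hleaf : ∀ e, a₁ ∈ ends e → e = f) (h13 : a₁ ≠ a₃) {o a₂ b : V} (h12 : a₁ ≠ a₂)
    (ho : o ≠ a₁) (hb : b ≠ a₁) : SharpHalves.HalfL p ends o a₁ a₂ a₃ b := by
  unfold SharpHalves.HalfL
  rw [GammaLc_root_leaf_a3 p ends hf hleaf h13 h12 ho hb]
  have hcross := (PendantRoot.covC_cross_nonpos p ends hp o a₃ a₂ b).1
  have hq0 := hp.nonneg f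
  have hq1 := sub_nonneg.2 (hp.le_one f)
  have hZ := prob_nonneg hp (avoidAll ends a₂ {a₃})
  have hmix : 0 ≤ 1 - p f + p f * prob p (avoidAll ends a₂ {a₃}) :=
    add_nonneg hq1 (mul_nonneg hq0 hZ)
  have hpre : 0 ≤ 2 * p f * (1 - p f) * (1 - p f + p f * prob p (avoidAll ends a₂ {a₃})) :=
    mul_nonneg (mul_nonneg (mul_nonneg (by norm_num) hq0) hq1) hmix
  nlinarith [mul_nonneg hpre (neg_nonneg.2 hcross)]

/-- **HALF-H when the root `a₁` is a leaf at `a₃`**: BHK06 Thm 1.3 on `C(a₂)` given `a₃ ∉ C(a₂)`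
(`C(oH, bH) ≥ 0`). -/
theorem HalfH_root_leaf_a3 (hp : IsProbVec p) {f : E} {a₁ a₃ : V} (hf : ends f = s(a₁, a₃))
    (hleaf : ∀ e, a₁ ∈ ends e → e = f) (h13 : a₁ ≠ a₃) {o a₂ b : V} (h12 : a₁ ≠ a₂)
    (ho : o ≠ a₁) (hb : b ≠ a₁) : SharpHalves.HalfH p ends o a₁ a₂ a₃ b := by
  unfold SharpHalves.HalfH
  rw [GammaHc_root_leaf_a3 p ends hf hleaf h13 h12 ho hb]
  have hsym : avoidAll ends a₂ {a₃} = avoidAll ends a₃ {a₂} := by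
    rw [PendantRoot.avoidAll_eq_compl, PendantRoot.avoidAll_eq_compl, connEvent_comm]
  have hsame : 0 ≤ PendantRoot.covC p ends a₃ a₂ (connEvent ends a₂ o) (connEvent ends a₂ b) := by
    have h := PendantRoot.covC_same_nonneg p ends hp o a₂ a₃ b
    unfold PendantRoot.covC at h ⊢
    rw [hsym]
    exact h
  have hq0 := hp.nonneg f
  have hq1 := sub_nonneg.2 (hp.le_one f)
  have hZ := prob_nonneg hp (avoidAll ends a₂ {a₃})
  have hmix : 0 ≤ 1 - p f + p f * prob p (avoidAll ends a₂ {a₃}) :=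
    add_nonneg hq1 (mul_nonneg hq0 hZ)
  exact mul_nonneg (mul_nonneg (mul_nonneg (mul_nonneg (by norm_num) hq0) hq1) hmix) hsame

/-- **HALF-L when the root `a₂` is a leaf at `a₃`** (the pendant-root instance of the `(Z, 1_T)`-fibre
decomposition; by the root symmetry `ΓLc(a₁, a₂) = ΓHc(a₂, a₁)`). -/
theorem HalfL_root_leaf_a3' (hp : IsProbVec p) {f : E} {a₂ a₃ : V} (hf : ends f = s(a₂, a₃))
    (hleaf : ∀ e, a₂ ∈ ends e → e = f) (h23 : a₂ ≠ a₃) {o a₁ b : V} (h21 : a₂ ≠ a₁)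
    (ho : o ≠ a₂) (hb : b ≠ a₂) : SharpHalves.HalfL p ends o a₁ a₂ a₃ b :=
  HalfH_root_leaf_a3 p ends hp hf hleaf h23 h21 ho hb

/-- **HALF-H when the root `a₂` is a leaf at `a₃`**. -/
theorem HalfH_root_leaf_a3' (hp : IsProbVec p) {f : E} {a₂ a₃ : V} (hf : ends f = s(a₂, a₃))
    (hleaf : ∀ e, a₂ ∈ ends e → e = f) (h23 : a₂ ≠ a₃) {o a₁ b : V} (h21 : a₂ ≠ a₁)
    (ho : o ≠ a₂) (hb : b ≠ a₂) : SharpHalves.HalfH p ends o a₁ a₂ a₃ b :=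
  HalfL_root_leaf_a3 p ends hp hf hleaf h23 h21 ho hb

end Theorems

end HalfLRootLeaf

end Summit.Ventures.PercRepro2
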